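import Summits.Ventures.Crystal3D.Bulk.RotSysFaceWalk
import Summits.Ventures.Crystal3D.Bulk.RotSysInsertEdge
import Summits.Ventures.Crystal3D.Bulk.ClockwiseGluing
import HarnessLib

/-!
# LEMMA L by edge insertion: in a planar connected rotation system drawn on the sphere, every
# face of a connected spanning sub-map all of whose corners are `< π` is a convex spherical
# polygon (generic form; `HOME/lean/lemmaL/DESIGN.md` R1.7′)

HONEST FRAMING. Part of the venture `Summits/Ventures/Crystal3D` (cell `pub-crystal3d`, phase 2;
seat typer-bulk-2). A generic theorem about a loopless rotation system `(σ, α)` on a finite dart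
type with a planar connected ambient map, weights `w ≥ 0` and a position map `pos` (the vertex of
a dart, as a vector of `ℝ³`), under two GEOMETRIC HYPOTHESES that the instantiation
(`Bulk/HullConvexFaces.lean`, hull fan of a spherical code) discharges: (BASE) every face walk of
the FULL map is clockwise convex (for the hull fan: the faces are the fan triangles, traversed
clockwise, `HullRotSys.orient3_faceTri_neg`), and (LINK) at a dart `z` of an `α`-closed `S` with
corner `cornerAt σ w S z < π` the two consecutive sides of the face walk through the vertex of `z`
make a right turn, `0 < orient3 (pos z) (pos (α z)) (pos (α (induce σ S z)))` (for the hull fan: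
p3's lifted-azimuth LINK LEMMA). Nothing here mentions GAP(1.26).

* `IsRotSys.cw_face_induction` / **`IsRotSys.cw_face`** — for every `α`-closed `S` with ONE
  component, a dart at EVERY vertex, and ALL corners `< π`, every face walk
  `i ↦ pos (φ_S^i x)` (`x ∈ S`, length `minimalPeriod φ_S x`) is clockwise convex:
  `∀ i < j < k, 0 < orient3 (walk k) (walk j) (walk i)`.

PROOF (edge insertion, no ears, no regions): induct on the number of darts outside `S`. If some
dart `d` is missing, insert the edge `{d, α d}`: the bigger set `T` is again closed, connected
(`numK_le_numK_sdiff_of_sameCycle`), spanning, and all its corners are `< π`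
(`cornerAt_lt_of_sdiff`, corners only shrink), so by induction all faces of `T` are convex. Both
ends of the new edge carry darts of `S`, so the deletion `T ↦ S` is never pendant, and planarity
(`chi2 = 4·numK` for `S` and `T`) makes it a MERGE (`not_sameCycle_phi_of_chi2_eq`): the face of
`S` through the ends of the edge is the two faces of `T` through `d` and `α d` glued along the
edge (its walk is `Bulk/RotSysFaceWalk.lean`'s merged walk), every other face of `S` is a face of
`T` verbatim. Two clockwise-convex walks glued along a common side stay clockwise convex
(`cw_glue`, from p3's `convexPos_glue`) as soon as the two corners of the union at the ends of the
side are convex — which is (LINK) at the two junction darts, whose corners in `S` are `< π`.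
-/

noncomputable section

namespace Summit.Ventures.Crystal3D

namespace RotSys

open Equiv Equiv.Perm Finset Function Literature.Geometry.DiscreteGeometry

variable {D : Type*} [DecidableEq D] [Fintype D]
variable {σ α : Perm D} {w : D → ℝ} {pos : D → EuclideanSpace ℝ (Fin 3)}

/-! ## Positions along walks -/

omit [DecidableEq D] [Fintype D] in
/-- Powers of the rotation keep the position. -/
theorem pos_pow_apply (hpos : ∀ x, pos (σ x) = pos x) (x : D) (k : ℕ) :
    pos ((σ ^ k) x) = pos x := by
  induction k with
  | zero => simp
  | succ k ih => rw [pow_succ', Perm.mul_apply, hpos, ih]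

omit [DecidableEq D] in
/-- Darts at one vertex have the same position. -/
theorem pos_eq_of_sameCycle (hpos : ∀ x, pos (σ x) = pos x) {x y : D} (h : σ.SameCycle x y) :
    pos y = pos x := by
  obtain ⟨k, hk⟩ := h.exists_nat_pow_eq
  rw [← hk]
  exact pos_pow_apply hpos x k

/-- The induced rotation keeps the position. -/
theorem pos_induce (hpos : ∀ x, pos (σ x) = pos x) (S : Finset D) (x : D) :
    pos (induce σ S x) = pos x :=
  pos_eq_of_sameCycle hpos (sameCycle_induce_apply σ S x)

/-- **The face walk moves to the far end of the dart**: `pos (φ_S x) = pos (α x)`. -/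
theorem pos_phi (hpos : ∀ x, pos (σ x) = pos x) (S : Finset D) (x : D) :
    pos (phi σ α S x) = pos (α x) := by
  rw [phi_apply, pos_induce hpos]

/-- **(LINK) along a walk**: at a dart `y ∈ S` whose reversed dart has corner `< π`, the three
consecutive walk vertices `pos y, pos (φ y), pos (φ² y)` form a clockwise (right) turn. -/
theorem link_triple (h : IsRotSys σ α) (hpos : ∀ x, pos (σ x) = pos x) {S : Finset D}
    (hS : IsClosed α S)
    (hlink : ∀ z ∈ S, cornerAt σ w S z < Real.pi →
      0 < orient3 (pos z) (pos (α z)) (pos (α (induce σ S z))))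
    {y : D} (hy : y ∈ S) (hc : cornerAt σ w S (α y) < Real.pi) :
    0 < orient3 (pos ((phi σ α S ^ 2) y)) (pos (phi σ α S y)) (pos y) := by
  have key := hlink (α y) (hS y hy) hc
  rw [h.α_inv, ← phi_apply, ← pos_phi hpos S y, ← pos_phi hpos S (phi σ α S y)] at key
  rw [orient3_cyclic, pow_two, Perm.mul_apply]
  exact key

/-! ## The induction -/

/-- **LEMMA L, generic edge-insertion form (the induction).** See the module docstring; the
statement quantifies over the number `n` of darts outside `S`. -/
theorem IsRotSys.cw_face_induction (h : IsRotSys σ α)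
    (hplanar : chi2 σ α (univ : Finset D) = 4 * (numK σ α (univ : Finset D) : ℤ))
    (hpos : ∀ x, pos (σ x) = pos x) (hw : ∀ x, 0 ≤ w x)
    (hlink : ∀ S : Finset D, IsClosed α S → ∀ z ∈ S, cornerAt σ w S z < Real.pi →
      0 < orient3 (pos z) (pos (α z)) (pos (α (induce σ S z))))
    (hbase : ∀ x : D, ∀ i j k : ℕ, i < j → j < k →
      k < minimalPeriod (phi σ α (univ : Finset D)) x →
      0 < orient3 (pos ((phi σ α univ ^ k) x)) (pos ((phi σ α univ ^ j) x))
        (pos ((phi σ α univ ^ i) x))) :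
    ∀ (n : ℕ) (S : Finset D), (univ \ S).card = n → IsClosed α S → numK σ α S = 1 →
      (∀ x : D, ∃ z ∈ S, σ.SameCycle x z) → (∀ z ∈ S, cornerAt σ w S z < Real.pi) →
      ∀ x ∈ S, ∀ i j k : ℕ, i < j → j < k → k < minimalPeriod (phi σ α S) x →
        0 < orient3 (pos ((phi σ α S ^ k) x)) (pos ((phi σ α S ^ j) x))
          (pos ((phi σ α S ^ i) x)) := by
  intro n
  induction n using Nat.strong_induction_on with
  | _ n ih =>
  intro S hn hS hK hspan hcorner x hx
  by_cases hfull : univ \ S = ∅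
  · -- `S = univ`: the base case
    have hSu : S = univ :=
      Finset.Subset.antisymm (subset_univ S) (Finset.sdiff_eq_empty_iff_subset.1 hfull)
    subst hSu
    exact hbase x
  -- a missing dart `d`; insert the edge `{d, α d}`
  obtain ⟨d, hd'⟩ := Finset.nonempty_iff_ne_empty.2 hfull
  have hdS : d ∉ S := (Finset.mem_sdiff.1 hd').2
  have hαdS : α d ∉ S := fun hmem => hdS (by have := hS _ hmem; rwa [h.α_inv] at this)
  set T : Finset D := S ∪ {d, α d} with hT_def
  have hdT : d ∈ T := mem_union_right _ (mem_insert_self _ _)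
  have hαdT : α d ∈ T := mem_union_right _ (mem_insert_of_mem (mem_singleton_self _))
  have hST : S ⊆ T := subset_union_left
  have hTS : T \ {d, α d} = S := by
    ext z
    rw [Finset.mem_sdiff, hT_def, mem_union, mem_insert, mem_singleton]
    constructor
    · rintro ⟨h1 | h1, h2⟩
      · exact h1
      · exact absurd h1 h2
    · intro hz
      refine ⟨Or.inl hz, ?_⟩
      rintro (rfl | rfl)
      · exact hdS hz
      · exact hαdS hz
  have hT : IsClosed α T := by
    intro z hz
    rw [hT_def, mem_union, mem_insert, mem_singleton] at hz ⊢
    rcases hz with hz | rfl | rfl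
    · exact Or.inl (hS z hz)
    · exact Or.inr (Or.inr rfl)
    · rw [h.α_inv]; exact Or.inr (Or.inl rfl)
  have hcard : (univ \ T).card < n := by
    rw [← hn]
    apply Finset.card_lt_card
    refine ⟨fun z hz => ?_, fun hsub => ?_⟩
    · rw [Finset.mem_sdiff] at hz ⊢
      exact ⟨hz.1, fun hzS => hz.2 (hST hzS)⟩
    · have := hsub hd'
      rw [Finset.mem_sdiff] at this
      exact this.2 hdT
  -- the hypotheses for `T`
  have hspanT : ∀ y : D, ∃ z ∈ T, σ.SameCycle y z := fun y => by
    obtain ⟨z, hz, hc⟩ := hspan y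
    exact ⟨z, hST hz, hc⟩
  obtain ⟨za, hzaS, hza⟩ := hspan d
  obtain ⟨zb, hzbS, hzb⟩ := hspan (α d)
  have hna : induce σ T d ≠ d :=
    induce_ne_self_of_mem_cycle σ hdT (hST hzaS) (fun e => hdS (e ▸ hzaS)) hza
  have hnb : induce σ T (α d) ≠ α d :=
    induce_ne_self_of_mem_cycle σ hαdT (hST hzbS) (fun e => hαdS (e ▸ hzbS)) hzb
  have hKT : numK σ α T = 1 := by
    apply le_antisymm
    · have hza' : za ∈ T \ {d, α d} := by rw [hTS]; exact hzaS
      have := h.numK_le_numK_sdiff_of_sameCycle hT hdT hza' hza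
      rw [hTS, hK] at this
      exact this
    · exact numClasses_pos _ ⟨d, hdT⟩
  have hcornerT : ∀ z ∈ T, cornerAt σ w T z < Real.pi :=
    h.cornerAt_lt_of_sdiff hT hdT hw hna hnb (fun z hz => by
      rw [hTS] at hz ⊢; exact hcorner z hz)
  -- induction hypothesis: every face of `T` is clockwise convex
  have ihT := ih _ hcard T rfl hT hKT hspanT hcornerT
  -- planarity makes the deletion `T ↦ S` a MERGE
  have hU : IsClosed α (univ : Finset D) := fun z _ => mem_univ _
  have hchiS := h.chi2_eq_of_subset hU hS (subset_univ S) hplanar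
  have hchiT := h.chi2_eq_of_subset hU hT (subset_univ T) hplanar
  have hdiff : ¬ (phi σ α T).SameCycle d (α d) :=
    h.not_sameCycle_phi_of_chi2_eq hT hdT hna hnb (by rw [hTS, hchiS, hchiT, hK, hKT])
  -- (LINK) along the walks of `S`
  have hlinkS : ∀ y ∈ S, 0 < orient3 (pos ((phi σ α S ^ 2) y)) (pos (phi σ α S y)) (pos y) :=
    fun y hy => link_triple h hpos hS (hlink S hS) hy (hcorner _ (hS y hy))
  -- periods and the pieces
  have hk2 := h.two_le_minimalPeriod_phi T d
  have hm2 := h.two_le_minimalPeriod_phi T (α d)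
  set k := minimalPeriod (phi σ α T) d with hk_def
  set m := minimalPeriod (phi σ α T) (α d) with hm_def
  set F₁ : ℕ → EuclideanSpace ℝ (Fin 3) := fun i => pos ((phi σ α T ^ i) d) with hF₁
  set F₂ : ℕ → EuclideanSpace ℝ (Fin 3) := fun i => pos ((phi σ α T ^ i) (α d)) with hF₂
  have hcw₁ : ∀ i j l, i < j → j < l → l < k → 0 < orient3 (F₁ l) (F₁ j) (F₁ i) :=
    ihT d hdT
  have hcw₂ : ∀ i j l, i < j → j < l → l < m → 0 < orient3 (F₂ l) (F₂ j) (F₂ i) :=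
    ihT (α d) hαdT
  -- the start of the merged walk and its period
  set x₀ := phi σ α T d with hx₀
  have hx₀S : x₀ ∈ S := by
    have := pow_phi_mem_sdiff_of_not_sameCycle hT hdT hdiff Nat.one_pos (by omega)
    rw [pow_one, hTS] at this
    exact this
  have hN : minimalPeriod (phi σ α S) x₀ = k + m - 2 := by
    have := h.minimalPeriod_phi_sdiff_merge hT hdT hdiff
    rw [hTS] at this
    exact this
  -- the merged walk as a concatenation
  have hwalk : ∀ i, i < k + m - 2 → pos ((phi σ α S ^ i) x₀) =
      if i + 1 < k then F₁ (i + 1) else F₂ (i + 2 - k) := by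
    intro i hi
    have := h.phi_sdiff_pow_apply_merge hT hdT hdiff hi
    rw [hTS, ← hk_def] at this
    rw [this]
    split_ifs <;> rfl
  -- the shared side: `F₁ 0 = F₂ 1 = pos d`, `F₁ 1 = F₂ 0 = pos (α d)`
  have ha : F₁ 0 = F₂ 1 := by
    simp only [hF₁, hF₂, pow_zero, pow_one, Perm.one_apply]
    rw [pos_phi hpos, h.α_inv]
  have hc : F₁ 1 = F₂ 0 := by
    simp only [hF₁, hF₂, pow_zero, pow_one, Perm.one_apply]
    rw [pos_phi hpos]
  -- periodicity of the merged walk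
  have hper : ∀ i, pos ((phi σ α S ^ (i % (k + m - 2))) x₀) = pos ((phi σ α S ^ i) x₀) := by
    intro i; rw [← hN, pow_mod_minimalPeriod_apply]
  -- CLOCKWISE CONVEXITY OF THE MERGED WALK from `x₀`
  have hmain : ∀ i j l, i < j → j < l → l < k + m - 2 →
      0 < orient3 (pos ((phi σ α S ^ l) x₀)) (pos ((phi σ α S ^ j) x₀))
        (pos ((phi σ α S ^ i) x₀)) := by
    rcases Nat.lt_or_ge k 3 with hk3 | hk3
    · -- `k = 2`: the merged walk IS the walk of `α d` in `T`
      refine cw_congr (n := k + m - 2) (v := F₂) (v' := fun t => pos ((phi σ α S ^ t) x₀))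
        (fun i hi => ?_) (fun i j l hij hjl hl => hcw₂ i j l hij hjl (by omega))
      show pos ((phi σ α S ^ i) x₀) = F₂ i
      rw [hwalk i hi]
      split_ifs with hlt
      · have hi0 : i = 0 := by omega
        subst hi0
        exact hc
      · congr 1; omega
    rcases Nat.lt_or_ge m 3 with hm3 | hm3
    · -- `m = 2`: the merged walk is the walk of `d` in `T`, shifted by one
      have hper₁ : ∀ i, F₁ (i % k) = F₁ i := fun i => by
        show pos ((phi σ α T ^ (i % k)) d) = pos ((phi σ α T ^ i) d)
        rw [hk_def, pow_mod_minimalPeriod_apply]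
      refine cw_congr (n := k + m - 2) (v := fun i => F₁ (i + 1))
        (v' := fun t => pos ((phi σ α S ^ t) x₀)) (fun i hi => ?_)
        (fun i j l hij hjl hl => cw_shift_of_mod (n := k) hcw₁ hper₁ 1 i j l hij hjl (by omega))
      show pos ((phi σ α S ^ i) x₀) = F₁ (i + 1)
      rw [hwalk i hi]
      split_ifs with hlt
      · rfl
      · have hi' : i = k - 1 := by omega
        subst hi'
        rw [show k - 1 + 2 - k = 1 by omega, ← ha, show k - 1 + 1 = k by omega, ← hper₁ k,
          Nat.mod_self]
    -- `k, m ≥ 3`: two-piece gluing, the corners coming from (LINK) at the junctions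
    have hca : 0 < orient3 (F₂ 2) (F₁ 0) (F₁ (k - 1)) := by
      -- (LINK) at `y = φ_S^(k-2) x₀`: the triple `W k, W (k-1), W (k-2)`
      have key := hlinkS ((phi σ α S ^ (k - 2)) x₀) (phi_pow_apply_mem hS hx₀S _)
      have e1 : (phi σ α S ^ 2) ((phi σ α S ^ (k - 2)) x₀) = (phi σ α S ^ k) x₀ := by
        rw [← Perm.mul_apply, ← pow_add, show 2 + (k - 2) = k by omega]
      have e2 : phi σ α S ((phi σ α S ^ (k - 2)) x₀) = (phi σ α S ^ (k - 1)) x₀ := by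
        rw [← Perm.mul_apply, ← pow_succ', show k - 2 + 1 = k - 1 by omega]
      rw [e1, e2, hwalk k (by omega), hwalk (k - 1) (by omega), hwalk (k - 2) (by omega),
        if_neg (by omega : ¬ (k + 1 < k)), if_neg (by omega : ¬ (k - 1 + 1 < k)),
        if_pos (by omega : k - 2 + 1 < k), show k + 2 - k = 2 by omega,
        show k - 1 + 2 - k = 1 by omega, show k - 2 + 1 = k - 1 by omega, ← ha] at key
      exact key
    have hcc : 0 < orient3 (F₁ 2) (F₁ 1) (F₂ (m - 1)) := by
      -- (LINK) at `y = φ_S^(N-1) x₀`: the triple `W (N+1) = W 1, W N = W 0, W (N-1)`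
      have key := hlinkS ((phi σ α S ^ (k + m - 2 - 1)) x₀) (phi_pow_apply_mem hS hx₀S _)
      have e1 : (phi σ α S ^ 2) ((phi σ α S ^ (k + m - 2 - 1)) x₀) =
          (phi σ α S ^ (1 + (k + m - 2))) x₀ := by
        rw [← Perm.mul_apply, ← pow_add, show 2 + (k + m - 2 - 1) = 1 + (k + m - 2) by omega]
      have e2 : phi σ α S ((phi σ α S ^ (k + m - 2 - 1)) x₀) = (phi σ α S ^ (k + m - 2)) x₀ := by
        rw [← Perm.mul_apply, ← pow_succ', show k + m - 2 - 1 + 1 = k + m - 2 by omega]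
      rw [e1, e2, ← hper (1 + (k + m - 2)), Nat.add_mod_right,
        Nat.mod_eq_of_lt (by omega : 1 < k + m - 2), ← hper (k + m - 2), Nat.mod_self,
        hwalk 1 (by omega), hwalk 0 (by omega), hwalk (k + m - 2 - 1) (by omega),
        if_pos (by omega : 1 + 1 < k), if_pos (by omega : 0 + 1 < k),
        if_neg (by omega : ¬ (k + m - 2 - 1 + 1 < k)),
        show k + m - 2 - 1 + 2 - k = m - 1 by omega] at key
      exact key
    exact cw_congr (n := k + m - 2) (v' := fun t => pos ((phi σ α S ^ t) x₀))
      (v := fun i => if i + 1 < k then F₁ (i + 1) else F₂ (i + 2 - k))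
      (fun i hi => hwalk i hi) (cw_glue hk3 hm3 hcw₁ hcw₂ ha hc hca hcc)
  -- FINALLY: the face of `x`
  by_cases hxU : (phi σ α T).SameCycle d x ∨ (phi σ α T).SameCycle (α d) x
  · -- `x` is on the merged face: its walk is a shift of the walk from `x₀`
    have hxmem : x ∈ (face σ α T d ∪ face σ α T (α d)) \ {d, α d} :=
      mem_U_iff.2 ⟨by rw [hTS]; exact hx, hxU⟩
    have hface := h.face_sdiff_eq_U_of_merge hT hdT hdiff (h.phi_mem_U hT hdT hdiff)
    rw [hTS] at hface
    have hxface : x ∈ face σ α S x₀ := by rw [hface]; exact hxmem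
    obtain ⟨-, hcyc⟩ := mem_face.1 hxface
    have hper_x : minimalPeriod (phi σ α S) x = k + m - 2 := by
      rw [← hN]; exact minimalPeriod_eq_of_sameCycle hS hx₀S hcyc
    obtain ⟨r, hr⟩ := hcyc.exists_nat_pow_eq
    intro i j l hij hjl hl
    rw [hper_x] at hl
    have e : ∀ t, pos ((phi σ α S ^ t) x) = pos ((phi σ α S ^ (t + r)) x₀) := fun t => by
      rw [← hr, ← Perm.mul_apply, ← pow_add]
    rw [e, e, e]
    exact cw_shift_of_mod (n := k + m - 2) (v := fun t => pos ((phi σ α S ^ t) x₀)) hmain hper r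
      i j l hij hjl hl
  · -- `x` is on an untouched face
    rw [not_or] at hxU
    have hxT : x ∈ T := hST hx
    have hpow : ∀ t, (phi σ α S ^ t) x = (phi σ α T ^ t) x := fun t => by
      have := h.phi_sdiff_pow_apply_of_not_sameCycle hT hdT hxT hxU.1 hxU.2 t
      rw [hTS] at this
      exact this
    have hperx : minimalPeriod (phi σ α S) x = minimalPeriod (phi σ α T) x := by
      have := h.minimalPeriod_phi_sdiff_of_not_sameCycle hT hdT hxT hxU.1 hxU.2
      rw [hTS] at this
      exact this
    intro i j l hij hjl hl
    rw [hpow, hpow, hpow]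
    rw [hperx] at hl
    exact ihT x hxT i j l hij hjl hl

/-- **LEMMA L, generic form.** In a loopless planar rotation system drawn on the sphere by `pos`
(constant on vertices), with non-negative weights satisfying (LINK) and faces of the full map
clockwise convex (BASE): for every `α`-closed dart set `S` with one component, a dart at every
vertex and all corners `< π`, every face walk of `S` is clockwise convex. -/
theorem IsRotSys.cw_face (h : IsRotSys σ α)
    (hplanar : chi2 σ α (univ : Finset D) = 4 * (numK σ α (univ : Finset D) : ℤ))
    (hpos : ∀ x, pos (σ x) = pos x) (hw : ∀ x, 0 ≤ w x)
    (hlink : ∀ S : Finset D, IsClosed α S → ∀ z ∈ S, cornerAt σ w S z < Real.pi →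
      0 < orient3 (pos z) (pos (α z)) (pos (α (induce σ S z))))
    (hbase : ∀ x : D, ∀ i j k : ℕ, i < j → j < k →
      k < minimalPeriod (phi σ α (univ : Finset D)) x →
      0 < orient3 (pos ((phi σ α univ ^ k) x)) (pos ((phi σ α univ ^ j) x))
        (pos ((phi σ α univ ^ i) x)))
    {S : Finset D} (hS : IsClosed α S) (hK : numK σ α S = 1)
    (hspan : ∀ x : D, ∃ z ∈ S, σ.SameCycle x z) (hcorner : ∀ z ∈ S, cornerAt σ w S z < Real.pi)
    {x : D} (hx : x ∈ S) :
    ∀ i j k : ℕ, i < j → j < k → k < minimalPeriod (phi σ α S) x →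
      0 < orient3 (pos ((phi σ α S ^ k) x)) (pos ((phi σ α S ^ j) x))
        (pos ((phi σ α S ^ i) x)) :=
  h.cw_face_induction hplanar hpos hw hlink hbase _ S rfl hS hK hspan hcorner x hx

end RotSys

end Summit.Ventures.Crystal3D

end
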